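import Summits.CriticalPhenomena.PercolationContinuityZ3.Theorems.PercNearOneGluingNoHeavyLowerTailMajorityGluingQCertVec
import Summits.CriticalPhenomena.PercolationContinuityZ3.Theorems.PercNearOneGluingNoHeavyLowerTailMajorityGluingQCertSevenFive116L1
import Summits.CriticalPhenomena.PercolationContinuityZ3.Theorems.PercNearOneGluingNoHeavyLowerTailMajorityGluingQCertSevenFive116R1
import Summits.CriticalPhenomena.PercolationContinuityZ3.Theorems.PercNearOneGluingNoHeavyLowerTailMajorityGluingQCertSevenFive116S1
import HarnessLib

/-!
# The `(7,5)` certificate with constant `29/25`: assembly and structural check (lane prim-rate, constants-miner 1, gen 35; CANDIDATES §GEN-35)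

Support file for the closed crux `NoHeavyLowerTail` (stmt-CriticalPhenomena-4575), majority-gluing line.  `sevenFive116` assembles the data files; `checkW` by `decide +kernel`; the quadratic check is chunked over the variable rows in `…QCertSevenFive116Q*`.  No sorries.
-/

namespace Summit.CriticalPhenomena.PercolationContinuityZ3.Theorems

namespace HubOnly
namespace QCert

/-- **The `(7,5)` certificate for the constant `29/25`** (case family `1`). The degree-2 certificate census/g35/jobs/j277671/CERT5_7_5_c29over25.json (mine-1 gen 35, kit j277671: cert5.py — cutting planes on the moment side over ALL hub-rooted van den Berg–Kahn rows and the 2×2 squares of variables/cylinders, case family `A` = «`E_x = μ(x attached, ≥ 5 cut)`», exact INTEGER multipliers (linear entries in 128 groups, 293 row instances, 35 squares), re-verified in the Lean semantics by census/g35/cert/gen5.py: `S ≥ 0` on all 8 385 pairs; variables `x_K`, `K < 128` = cut patterns of seven relays, `x_128 = δ`). -/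
def sevenFive116 : Cert := ⟨7, 5, 29, 25, 1, sevenFive116Lin1, sevenFive116Rows1, sevenFive116Sqs1⟩

set_option maxHeartbeats 0 in
/-- The structural check passes. -/
theorem sevenFive116_checkW : sevenFive116.checkW = true := by decide +kernel

end QCert
end HubOnly

end Summit.CriticalPhenomena.PercolationContinuityZ3.Theorems
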